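import Mathlib.RingTheory.Derivation.Basic
import Mathlib.RingTheory.Localization.AtPrime.Basic
import Mathlib.Algebra.CharP.Lemmas
import HarnessLib

/-!
# Stub `stub_leibnizObstruction` for crux stmt-ResolutionOfSingularities-15917
(`RadicialJung.CleanModels`)

The Leibniz obstruction (Stacks 07PF in the form used by the generisation argument). Let
`φ : O → E` be a ring homomorphism into a ring of characteristic `p`, `q ⊆ O` and `Q ⊆ E` primes
with `φ⁻¹(Q) = q`, `D` a derivation of `E` and `f ∈ O` with `D(φ f) ∉ Q`. Then in a localisation
`O'` of `O` at `q`, for every `c ∈ O'` with `f - c^p ∈ 𝔪_{O'}` one has `f - c^p ∉ 𝔪_{O'}²`.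

Proof. Write `c = a/s` with `s ∉ q` and put `g = s^p f - a^p ∈ O`, so that `s^p (f - c^p) = g`
in `O'`; as `f - c^p ∈ 𝔪_{O'}`, `g ∈ q`. If `f - c^p ∈ 𝔪_{O'}² = (q²)O'`, then `m g ∈ q²` for some
`m ∉ q`, hence `φ(m) φ(g) ∈ Q²`. A derivation maps `Q²` into `Q` (Leibniz), so
`φ(m) D(φ g) + φ(g) D(φ m) ∈ Q`; with `φ(g) ∈ Q` and `φ(m) ∉ Q` this forces `D(φ g) ∈ Q`. But `D`
kills `p`-th powers in characteristic `p` (`D(x^p) = p x^{p-1} D x = 0`), so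
`D(φ g) = φ(s)^p D(φ f) ∉ Q` — a contradiction.
-/

set_option linter.dupNamespace false

open IsLocalRing

namespace Summit.ResolutionOfSingularities.ResolutionOfSingularities.Theorems.RadicialJung.CleanModels

/-- **A derivation maps the square of an ideal into the ideal.** For `x ∈ Q²` one has `D x ∈ Q`,
by the Leibniz rule `D(ab) = a D b + b D a`. -/
theorem derivation_apply_mem_of_mem_sq {R E : Type*} [CommSemiring R] [CommRing E] [Algebra R E]
    (D : Derivation R E E) (Q : Ideal E) {x : E} (hx : x ∈ Q ^ 2) : D x ∈ Q := by
  rw [pow_two] at hx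
  refine Submodule.mul_induction_on hx (fun a ha b hb => ?_) (fun a b ha hb => ?_)
  · rw [Derivation.leibniz, smul_eq_mul, smul_eq_mul]
    exact Q.add_mem (Q.mul_mem_right _ ha) (Q.mul_mem_right _ hb)
  · rw [map_add]
    exact Q.add_mem ha hb

/-- **Derivations kill `p`-th powers in characteristic `p`:** `D (x^p) = p x^{p-1} D x = 0`. -/
theorem derivation_apply_pow_charP {R E : Type*} [CommSemiring R] [CommRing E] [Algebra R E]
    (p : ℕ) [CharP E p] (D : Derivation R E E) (x : E) : D (x ^ p) = 0 := by
  rw [Derivation.leibniz_pow, nsmul_eq_mul, CharP.cast_eq_zero E p, zero_mul]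

/-- **The Leibniz obstruction (Stacks 07PF, as used).** Let `φ : O → E` be a ring homomorphism
into a ring of prime characteristic `p`, `q ⊆ O` and `Q ⊆ E` primes with `φ⁻¹(Q) = q`, `D` a
derivation of `E` and `f ∈ O` with `D(φ f) ∉ Q`. Then in the localisation `O_q`, for every `c`
with `f - c^p ∈ 𝔪_q` one has `f - c^p ∉ 𝔪_q²`. (Write `c = a/s`; then `g = s^p f - a^p ∈ q`,
`D(φ g) = φ(s)^p D(φ f) ∉ Q` as `D` kills `p`-th powers, while `f - c^p ∈ 𝔪_q²` would give
`m g ∈ q²` for some `m ∉ q`, and `D(φ(Q²)) ⊆ Q` by Leibniz.) -/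
theorem stub_leibnizObstruction {O E : Type*} [CommRing O] [CommRing E] (φ : O →+* E) (p : ℕ)
    (hp : p.Prime) [CharP E p] (q : Ideal O) [q.IsPrime] (Q : Ideal E) [Q.IsPrime]
    (hQ : Q.comap φ = q) (D : Derivation ℤ E E) (f : O) (hf : D (φ f) ∉ Q) {O' : Type*}
    [CommRing O'] [IsLocalRing O'] [Algebra O O'] [IsLocalization.AtPrime O' q] (c : O')
    (hc : algebraMap O O' f - c ^ p ∈ maximalIdeal O') :
    algebraMap O O' f - c ^ p ∉ maximalIdeal O' ^ 2 := by
  intro h2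
  -- membership in `Q` versus `q` along `φ`
  have hφ : ∀ x : O, φ x ∈ Q ↔ x ∈ q := fun x => by rw [← hQ, Ideal.mem_comap]
  -- write `c = a / s` with `s ∉ q` and clear denominators: `s^p (f - c^p) = s^p f - a^p`
  obtain ⟨a, s, rfl⟩ := IsLocalization.exists_mk'_eq q.primeCompl c
  have hkey : algebraMap O O' ((s : O) ^ p * f - a ^ p) =
      algebraMap O O' s ^ p * (algebraMap O O' f - IsLocalization.mk' O' a s ^ p) := by
    rw [map_sub, map_mul, map_pow, map_pow, mul_sub, ← mul_pow, IsLocalization.mk'_spec' O' a s]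
  -- (i) `g = s^p f - a^p ∈ q`
  have hgq : (s : O) ^ p * f - a ^ p ∈ q := by
    refine (IsLocalization.AtPrime.to_map_mem_maximal_iff O' q _).mp ?_
    rw [hkey]
    exact Ideal.mul_mem_left _ _ hc
  -- (ii) `m g ∈ q²` for some `m ∉ q`
  obtain ⟨m, hm, hmg⟩ : ∃ m ∈ q.primeCompl, m * ((s : O) ^ p * f - a ^ p) ∈ q ^ 2 := by
    rw [← IsLocalization.algebraMap_mem_map_algebraMap_iff q.primeCompl O', Ideal.map_pow,
      IsLocalization.AtPrime.map_eq_maximalIdeal q O', hkey]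
    exact Ideal.mul_mem_left _ _ h2
  -- (iii) push forward along `φ`
  have hφ2 : φ (m * ((s : O) ^ p * f - a ^ p)) ∈ Q ^ 2 := by
    have hle : (q ^ 2).map φ ≤ Q ^ 2 := by
      rw [Ideal.map_pow, ← hQ]
      exact Ideal.pow_right_mono Ideal.map_comap_le 2
    exact hle (Ideal.mem_map_of_mem φ hmg)
  -- (iv) Leibniz: `φ m • D (φ g) + φ g • D (φ m) ∈ Q`, `φ g ∈ Q`, `φ m ∉ Q`, so `D (φ g) ∈ Q`
  have hD : D (φ m * φ ((s : O) ^ p * f - a ^ p)) ∈ Q := by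
    rw [← map_mul]
    exact derivation_apply_mem_of_mem_sq D Q hφ2
  rw [Derivation.leibniz, smul_eq_mul, smul_eq_mul] at hD
  have hDg : D (φ ((s : O) ^ p * f - a ^ p)) ∈ Q := by
    have h3 : φ m * D (φ ((s : O) ^ p * f - a ^ p)) ∈ Q :=
      (Ideal.add_mem_iff_left Q (Q.mul_mem_right _ ((hφ _).mpr hgq))).mp hD
    exact (‹Q.IsPrime›.mem_or_mem h3).resolve_left fun h =>
      Ideal.mem_primeCompl_iff.mp hm ((hφ m).mp h)
  -- (v) but `D` kills `p`-th powers, so `D (φ g) = φ s ^ p * D (φ f) ∉ Q`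
  have hDg' : D (φ ((s : O) ^ p * f - a ^ p)) = φ s ^ p * D (φ f) := by
    rw [map_sub, map_mul, map_pow, map_pow, map_sub, Derivation.leibniz,
      derivation_apply_pow_charP p D, derivation_apply_pow_charP p D, smul_zero, add_zero,
      sub_zero, smul_eq_mul]
  rw [hDg'] at hDg
  rcases ‹Q.IsPrime›.mem_or_mem hDg with h | h
  · exact Ideal.mem_primeCompl_iff.mp s.2 ((hφ s).mp ((‹Q.IsPrime›.pow_mem_iff_mem p hp.pos).mp h))
  · exact hf h

end Summit.ResolutionOfSingularities.ResolutionOfSingularities.Theorems.RadicialJung.CleanModels
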